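import Summits.Ventures.YMGap.Thresholds.StarFront
import Summits.Ventures.YMGap.Thresholds.StarGaugeReceivedSum
import HarnessLib

/-!
# Venture YMGap — track (c) «DS»: the K-row endpoint «strong-coupling front of `SU(2)` at
# `β_W = 1/3`», conditional on the gauge-fixed star lemma (capstone of HOME/ds/LEAN-KROW.md)

HONEST FRAMING: venture file (cell `pub-ymgap`), strong-coupling LATTICE bookkeeping only. This file
states the END of the cell's kernel-row programme for track (c) (PLAN R94/R96) with exactly ONE
hypothesis, the assembly target of brick B4 (`starWindowBound_lemmaG`, seat ds-4):

  `hG : ∀ L ≥ 3, ∀ β_W ∈ [0, 1/3], StarWindowBound L β_W (gaugeR β_W) suFrobDist`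

— the cell's Lemma G (gauge averaging at the star centre, freezing one link, Föllmer's comparison
with two boundary conditions inside the 7-link gauge-fixed star, received sum
`gaugeR β_W = 6c(1+c)/(1−4c−6c²)`, `c = β_W/4`, `= 13/15` at `β_W = 1/3`; class A + P behind K as of
this file, a kernel theorem once B4 lands) — and concludes, through `su2Star_strongCouplingFront`
(`StarFront.lean`), `CrossoverLedger.StrongCouplingFront (fundamentalLatticeRep 2) (1/6)`: the
`SU(2)` strong-coupling front of the crossover ledger at tree coupling `1/6` = Wilson `β_W = 1/3`
(the single-link front of the tree stands at `β_W < 2/9`). Nothing is asserted about `hG`; no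
continuum, confinement or mass-gap claim.

Contents: `gaugeR_mono` (the received sum is monotone in `β_W` on `[0, 7/10]`),
`su2_strongCouplingFront_oneSixth_of_lemmaG`.
-/

noncomputable section

open Literature.MathematicalPhysics.QuantumLattice (fundamentalRep fundamentalLatticeRep)
open Literature.MathematicalPhysics.QuantumFieldTheory
open Literature.MathematicalPhysics.QuantumFieldTheory.Balaban1983to89
open Summit.Ventures.YMGap.StarWindowGauge

namespace Summit.Ventures.YMGap.DSWindow

/-- **The gauge-star received sum is monotone in the coupling**: for `0 ≤ β ≤ β' ≤ 7/10`,
`gaugeR β ≤ gaugeR β'` (numerator `6c(1+c)` increasing and nonnegative, denominator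
`Δ(c) = 1 − 4c − 6c²` positive and decreasing on `c ≤ 7/40`). -/
theorem gaugeR_mono {β β' : ℝ} (h0 : 0 ≤ β) (h : β ≤ β') (h' : β' ≤ 7 / 10) :
    gaugeR β ≤ gaugeR β' := by
  have hc1 : β / 4 ≤ 7 / 40 := by linarith
  have hc1' : β' / 4 ≤ 7 / 40 := by linarith
  have hΔ := Delta_pos (c := β / 4) (by linarith) hc1
  have hΔ' := Delta_pos (c := β' / 4) (by linarith) hc1'
  have hN : 6 * (β / 4) * (1 + β / 4) ≤ 6 * (β' / 4) * (1 + β' / 4) := by nlinarith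
  have hN0 : 0 ≤ 6 * (β' / 4) * (1 + β' / 4) := by
    have : 0 ≤ β' := h0.trans h
    positivity
  have hD : Delta (β' / 4) ≤ Delta (β / 4) := by unfold Delta; nlinarith
  unfold gaugeR
  calc 6 * (β / 4) * (1 + β / 4) / Delta (β / 4)
      ≤ 6 * (β' / 4) * (1 + β' / 4) / Delta (β / 4) := div_le_div_of_nonneg_right hN hΔ.le
    _ ≤ 6 * (β' / 4) * (1 + β' / 4) / Delta (β' / 4) := div_le_div_of_nonneg_left hN0 hΔ' hD

/-- **The K-row endpoint, conditional on Lemma G's window bound.** If on every torus `(ℤ/L)^4`,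
`L ≥ 3`, and for every Wilson coupling `0 ≤ β_W ≤ 1/3` the vertex-star window bound holds with the
gauge-star received sum `gaugeR β_W` and the Frobenius weight (= the assembly target
`starWindowBound_lemmaG` of the cell's brick B4), then the `SU(2)` STRONG-COUPLING FRONT of the
crossover ledger holds at tree coupling `1/6` (Wilson `β_W = 1/3`):
`CrossoverLedger.StrongCouplingFront (fundamentalLatticeRep 2) (1/6)`, with the single clustering
rate `starRate (13/15) = (2/15)²/(2(16·13/15 + 1)) = 2/3345` (`gaugeR (1/3) = 13/15`,
`gaugeR_mono`, monotonicity of the schema in `ρ`, `su2Star_strongCouplingFront`). The hypothesis is NOT proved here. -/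
theorem su2_strongCouplingFront_oneSixth_of_lemmaG
    (hG : ∀ (L : ℕ) [NeZero L], 3 ≤ L → ∀ βW : ℝ, 0 ≤ βW → βW ≤ 1 / 3 →
      StarWindowBound L βW (gaugeR βW) suFrobDist) :
    CrossoverLedger.StrongCouplingFront (fundamentalLatticeRep 2) (1 / 6) := by
  have h := su2Star_strongCouplingFront (1 / 3) (ρ := 13 / 15) (by norm_num) (by norm_num) 1
    (fun βW h0 h1 S hS => by
      obtain ⟨K, hK, hKloc, hcontract, hsum⟩ := hG (2 * S + 1) (by omega) βW h0 h1
      exact ⟨K, hK, hKloc, hcontract, fun s x hx => (hsum s x hx).trans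
        ((gaugeR_mono h0 h1 (by norm_num)).trans_eq gaugeR_oneThird)⟩)
  have e : (1 / 3 : ℝ) / 2 = 1 / 6 := by norm_num
  rw [e] at h
  exact h

/-- **General threshold form of the K-row endpoint.** For any `0 ≤ β₀ ≤ 7/10` with
`gaugeR β₀ < 1` (i.e. `β₀ < (√37 − 5)/3 ≈ 0.3609`; e.g. `β₀ = 1/3`: `13/15`, `β₀ = 9/25`:
`2943/2957`): if on every torus `(ℤ/L)^4`, `L ≥ 3`, and for every Wilson coupling `0 ≤ β_W ≤ β₀` the
vertex-star window bound holds with received sum `gaugeR β_W` and the Frobenius weight (the cell's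
Lemma G, brick B4), then `CrossoverLedger.StrongCouplingFront (fundamentalLatticeRep 2) (β₀/2)` with
the single rate `starRate (gaugeR β₀)` (`gaugeR_mono`, monotonicity of the schema in `ρ`,
`su2Star_strongCouplingFront`). The hypothesis is NOT proved here. -/
theorem su2_strongCouplingFront_of_lemmaG (β₀ : ℝ) (h0 : 0 ≤ β₀) (h7 : β₀ ≤ 7 / 10)
    (hρ : gaugeR β₀ < 1)
    (hG : ∀ (L : ℕ) [NeZero L], 3 ≤ L → ∀ βW : ℝ, 0 ≤ βW → βW ≤ β₀ →
      StarWindowBound L βW (gaugeR βW) suFrobDist) :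
    CrossoverLedger.StrongCouplingFront (fundamentalLatticeRep 2) (β₀ / 2) := by
  have hρ0 : 0 ≤ gaugeR β₀ := by
    have hΔ := Delta_pos (c := β₀ / 4) (by linarith) (by linarith)
    unfold gaugeR
    positivity
  exact su2Star_strongCouplingFront β₀ hρ0 hρ 1 fun βW hβ0 hβ1 S hS => by
    obtain ⟨K, hK, hKloc, hcontract, hsum⟩ := hG (2 * S + 1) (by omega) βW hβ0 hβ1
    exact ⟨K, hK, hKloc, hcontract, fun s x hx => (hsum s x hx).trans (gaugeR_mono hβ0 hβ1 h7)⟩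

end Summit.Ventures.YMGap.DSWindow

end
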